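import Summits.BirchSwinnertonDyer.BirchSwinnertonDyer.Theorems.EisensteinDepletionAtTwoStarStabCoeff
import Literature.NumberTheory.ModularForms.DedekindSumHeckeOperators
import Mathlib.Data.Finset.NatDivisors
import HarnessLib

/-!
# Route `EisensteinDepletionAtTwo`, crux E1M_NSF `DepletedLambdaLawAtTwoModNSF` (stmt-BirchSwinnertonDyer-27021) and its
# GO₂-child `StarGO2Sigma` (stmt-BirchSwinnertonDyer-27046): the stabilised Eisenstein period `φ_β = stabEisensteinPeriod N β`
# is `U_ℓ`-NULL at a fully depleted prime `ℓ² ∥ N` (the transfer identity (U2) of planner memo SIGMA-NSF-UNTWIST §1/§4(c))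

Cell `bsd-rank2` (HOME run/shared/lean/pub/bsd-rank2/), seat `bsd-rank2-eng-2` GEN 16. THEOREMS ONLY — no definition, no named
fact, no `sorry`. HONEST FRAMING: Dedekind-sum bookkeeping on the Eisenstein side of line `star`; nothing here reads an analytic
rank; StarGO2Sigma / StarOptBNSF / E1M_NSF / BSD are NOT proved by this file (PARTITION D-0054: none — r_an ≥ 2 axis S0, door T-r3₂).

**The Hecke correspondence `U_ℓ` on `Γ₀(N)` (`ℓ ∣ N`).** For `γ = (a b; c d) ∈ Γ₀(N)` and `α_j = (1 j; 0 ℓ)` (`0 ≤ j < ℓ`) one has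
`α_j γ = γ_j α_{σ(j)}` with `γ_j = (a + jc, (b + jd − σ_j(a + jc))/ℓ; ℓc, d − σ_j c) ∈ Γ₀(N)` for ANY integers `σ_j` with
`ℓ ∣ b + jd − σ_j(a + jc)` (then `σ_j ≡ a⁻¹(b + jd) (mod ℓ)`, a permutation of the residues); for a weight-2 form `F` on `Γ₀(N)`
with period homomorphism `φ_F(γ) = ∫_{z₀}^{γz₀} F`, `φ_{U_ℓ F}(γ) = ∑_j φ_F(γ_j)` (the boundary terms telescope).
[cite: Stevens1982, §2.4–2.5] The stabilised Eisenstein series `E_β = ∏_{ℓ'} L_{ℓ'}(V_{ℓ'}) E₂` of line `star` carries, at a prime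
`ℓ² ∥ N`, the FULL depletion factor `1 − (1+ℓ)B_ℓ + ℓB_ℓ² = (1 − B_ℓ)(1 − ℓB_ℓ)` (`localStabCoeff` at exponent `2`), so `U_ℓ E_β = 0`;
this file proves the corresponding EXACT identity for the tree's `ℚ`-valued period function `φ_β` (Rademacher `Φ` / Dedekind sums),
arithmetically (no analysis):

* **`stabEisensteinPeriod_heckeU_sum_eq_zero`** — `ℓ` prime, `N.factorization ℓ = 2`, `β` admissible, `ad − bc = 1`, `N ∣ c`,
  `σ : ℕ → ℤ` with `ℓ ∣ b + jd − σ_j(a + jc)` for `j < ℓ`:  `∑_{j<ℓ} φ_β(γ_j) = 0`.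

Mechanism (per divisor class `t = ℓ^e t₀`, `t₀ ∣ N/ℓ²`, `K = |c|/t₀ = ℓ²K₂`): the Dedekind-sum parts are
`e = 0`: `∑_j s(d − σ_j c, ℓK) = ∑_{m<ℓ} s(d + mK, ℓK) = (ℓ+1)s(d,K) − s(ℓd,K)` (KNOPP's identity at a prime,
`Literature.NumberTheory.ModularForms.sum_dedekindSum_add_mul_eq`); `e = 1`: `ℓ·s(d, K)`; `e = 2`: `ℓ·s(d, K/ℓ)`; with the depletion
weights `(1, −(1+ℓ)/ℓ, 1/ℓ)` they sum to `s(d, K/ℓ) − s(ℓd, K) = 0` (`s(ℓh, ℓk) = s(h,k)`); the rational parts `(A_j + D_j)/C_j` sum to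
a multiple of `∑_t c_t t = 0` (`sum_divisors_stabCoeff_mul_self_eq_zero`).  Exact-rational numerics (seat folder `work/u2/u2check.py`):
78/78 random `γ ∈ Γ₀(N)` at `N ∈ {9,25,45,63,75,99,147,171,225}`; controls at `ℓ ∥ N` show the eigenvalue `ℓ/β_ℓ` instead.

References: M. I. Knopp, J. Number Theory 12 (1980) 2–9 [Knopp1980]; G. Stevens, *Arithmetic on Modular Curves*, Progr. Math. 20
(1982) §2.4–2.5 [Stevens1982]; H. Rademacher, E. Grosswald, *Dedekind Sums*, Carus 16 (1972) Ch. 4 [RademacherGrosswald1972].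
-/

set_option linter.dupNamespace false
set_option autoImplicit false

noncomputable section

open Finset Literature.NumberTheory.ModularForms

namespace Summit.BirchSwinnertonDyer.BirchSwinnertonDyer.Theorems.DepletionAtTwo

/-! ### §1 Finite-sum plumbing -/

/-- Reindexing a sum over `0, …, ℓ − 1` along a map `r` that permutes the range (injective, range-valued). [folklore] -/
private theorem sum_range_reindex {ℓ : ℕ} (r : ℕ → ℕ) (hr : ∀ j ∈ range ℓ, r j ∈ range ℓ)
    (hinj : Set.InjOn r (range ℓ : Set ℕ)) (f : ℕ → ℚ) :
    ∑ j ∈ range ℓ, f (r j) = ∑ m ∈ range ℓ, f m := by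
  have himg : (range ℓ).image r = range ℓ := by
    apply eq_of_subset_of_card_le
    · intro x hx
      rw [mem_image] at hx
      obtain ⟨j, hj, rfl⟩ := hx
      exact hr j hj
    · rw [card_image_of_injOn hinj, card_range]
  rw [← sum_image hinj, himg]

/-- Divisors of `ℓ^k · N'` with `ℓ ∤ N'` (`ℓ` prime, `N' ≠ 0`): `∑_{t ∣ ℓ^k N'} F(t) = ∑_{t₀ ∣ N'} ∑_{e ≤ k} F(ℓ^e t₀)`. [folklore] -/
private theorem sum_divisors_primePow_mul {ℓ N' : ℕ} (hℓ : ℓ.Prime) (hN' : ¬ ℓ ∣ N') (k : ℕ)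
    (F : ℕ → ℚ) :
    ∑ t ∈ (ℓ ^ k * N').divisors, F t = ∑ t₀ ∈ N'.divisors, ∑ e ∈ range (k + 1), F (ℓ ^ e * t₀) := by
  have hcop : (ℓ ^ k).Coprime N' := Nat.Coprime.pow_left k ((Nat.Prime.coprime_iff_not_dvd hℓ).mpr hN')
  rw [Nat.divisors_mul, Finset.mul_def, Finset.sum_image hcop.mul_injOn_divisors, Finset.sum_product,
    Nat.divisors_prime_pow hℓ k, Finset.sum_map, Finset.sum_comm]
  rfl

/-! ### §2 The Dedekind-sum block at a fully depleted prime -/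

/-- **The Dedekind-sum block vanishes at `ℓ² ∥ N`.** For `ℓ` prime with `N.factorization ℓ = 2`, `N ∣ C ≠ 0`, `d ∈ ℤ` and
integers `ρ_j` (`j < ℓ`) pairwise incongruent modulo `ℓ`:
`∑_{t ∣ N} c_t · ∑_{j<ℓ} s(d + ρ_j C, ℓC/t) = 0`.  (Per class `t = ℓ^e t₀`: Knopp at `e = 0`, periodicity at `e = 1, 2`,
weights `(1, −(1+ℓ)/ℓ, 1/ℓ)`, and `s(ℓh, ℓk) = s(h, k)`.) [cite: Knopp1980, Theorem (n prime)] [cite: Stevens1982, §2.4–2.5] -/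
theorem sum_divisors_stabCoeff_mul_sum_dedekindSum_eq_zero {N ℓ : ℕ} (hℓ : ℓ.Prime) (hℓN : N.factorization ℓ = 2)
    (β : ℕ → ℕ) {C : ℕ} (hC : N ∣ C) (hC0 : C ≠ 0) (d : ℤ) (ρ : ℕ → ℤ)
    (hinj : ∀ j ∈ range ℓ, ∀ j' ∈ range ℓ, (ℓ : ℤ) ∣ ρ j - ρ j' → j = j') :
    ∑ t ∈ N.divisors, stabCoeff N β t * ∑ j ∈ range ℓ, dedekindSum (d + ρ j * C) (ℓ * C / t) = 0 := by
  have hN0 : N ≠ 0 := by rintro rfl; simp at hℓN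
  have hℓmem : ℓ ∈ N.primeFactors := by
    rw [Nat.mem_primeFactors]; exact ⟨hℓ, Nat.dvd_of_factorization_pos (by rw [hℓN]; norm_num), hN0⟩
  -- `N = ℓ² N'`, `ℓ ∤ N'`
  set N' : ℕ := N / ℓ ^ 2 with hN'
  have hNdecomp : N = ℓ ^ 2 * N' := by
    rw [hN', ← hℓN]
    exact (Nat.ordProj_mul_ordCompl_eq_self N ℓ).symm
  have hℓN' : ¬ ℓ ∣ N' := by rw [hN', ← hℓN]; exact Nat.not_dvd_ordCompl hℓ hN0
  have hN'0 : N' ≠ 0 := by rintro h; rw [h, mul_zero] at hNdecomp; exact hN0 hNdecomp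
  rw [show N.divisors = (ℓ ^ 2 * N').divisors by rw [← hNdecomp], sum_divisors_primePow_mul hℓ hℓN' 2]
  refine sum_eq_zero fun t₀ ht₀ => ?_
  rw [Nat.mem_divisors] at ht₀
  obtain ⟨ht₀N', -⟩ := ht₀
  have ht₀0 : t₀ ≠ 0 := ne_zero_of_dvd_ne_zero hN'0 ht₀N'
  have hℓt₀ : ¬ ℓ ∣ t₀ := fun h => hℓN' (h.trans ht₀N')
  -- `C = ℓ² t₀ K₂`
  obtain ⟨K₂, hK₂⟩ : ℓ ^ 2 * t₀ ∣ C := (mul_dvd_mul_left (ℓ ^ 2) ht₀N').trans (hNdecomp ▸ hC)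
  have hK₂0 : K₂ ≠ 0 := by rintro rfl; rw [mul_zero] at hK₂; exact hC0 hK₂
  have hK₂pos : 0 < K₂ := Nat.pos_of_ne_zero hK₂0
  have hℓpos := hℓ.pos
  -- the three moduli `ℓC/(ℓ^e t₀)`
  have hm0 : ℓ * C / (ℓ ^ 0 * t₀) = ℓ * (ℓ ^ 2 * K₂) := by
    rw [pow_zero, one_mul, hK₂, show ℓ * (ℓ ^ 2 * t₀ * K₂) = t₀ * (ℓ * (ℓ ^ 2 * K₂)) by ring,
      Nat.mul_div_cancel_left _ (Nat.pos_of_ne_zero ht₀0)]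
  have hm1 : ℓ * C / (ℓ ^ 1 * t₀) = ℓ ^ 2 * K₂ := by
    rw [pow_one, hK₂, show ℓ * (ℓ ^ 2 * t₀ * K₂) = ℓ * t₀ * (ℓ ^ 2 * K₂) by ring,
      Nat.mul_div_cancel_left _ (by positivity)]
  have hm2 : ℓ * C / (ℓ ^ 2 * t₀) = ℓ * K₂ := by
    rw [hK₂, show ℓ * (ℓ ^ 2 * t₀ * K₂) = ℓ ^ 2 * t₀ * (ℓ * K₂) by ring,
      Nat.mul_div_cancel_left _ (by positivity)]
  -- the coefficients `c_{ℓ^e t₀} = c_ℓ(e) · c_{t₀}`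
  have hcoef : ∀ e : ℕ, stabCoeff N β (ℓ ^ e * t₀) = localStabCoeff N β ℓ e * stabCoeff N β t₀ := by
    intro e
    rw [stabCoeff_mul N β (pow_ne_zero _ hℓ.ne_zero) ht₀0
      ((Nat.Coprime.pow_left e ((Nat.Prime.coprime_iff_not_dvd hℓ).mpr hℓt₀))),
      stabCoeff_prime_pow N β hℓmem]
  have hlam0 : localStabCoeff N β ℓ 0 = 1 := localStabCoeff_zero N β ℓ
  have hlam1 : localStabCoeff N β ℓ 1 = -((1 : ℚ) + ℓ) / ℓ := by
    simp [localStabCoeff, hℓN]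
  have hlam2 : localStabCoeff N β ℓ 2 = (1 : ℚ) / ℓ := by
    simp [localStabCoeff, hℓN]
  -- e = 1 and e = 2: periodicity
  have hC' : (C : ℤ) = (ℓ : ℤ) ^ 2 * t₀ * K₂ := by exact_mod_cast hK₂
  have he1 : ∑ j ∈ range ℓ, dedekindSum (d + ρ j * C) (ℓ ^ 2 * K₂) = (ℓ : ℚ) * dedekindSum d (ℓ ^ 2 * K₂) := by
    rw [sum_congr rfl fun j _ => show dedekindSum (d + ρ j * C) (ℓ ^ 2 * K₂) = dedekindSum d (ℓ ^ 2 * K₂) by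
      rw [hC', show d + ρ j * ((ℓ : ℤ) ^ 2 * t₀ * K₂) = d + (ρ j * t₀) * ((ℓ ^ 2 * K₂ : ℕ) : ℤ) by push_cast; ring,
        dedekindSum_add_mul]]
    rw [sum_const, card_range, nsmul_eq_mul]
  have he2 : ∑ j ∈ range ℓ, dedekindSum (d + ρ j * C) (ℓ * K₂) = (ℓ : ℚ) * dedekindSum d (ℓ * K₂) := by
    rw [sum_congr rfl fun j _ => show dedekindSum (d + ρ j * C) (ℓ * K₂) = dedekindSum d (ℓ * K₂) by
      rw [hC', show d + ρ j * ((ℓ : ℤ) ^ 2 * t₀ * K₂) = d + (ρ j * t₀ * ℓ) * ((ℓ * K₂ : ℕ) : ℤ) by push_cast; ring,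
        dedekindSum_add_mul]]
    rw [sum_const, card_range, nsmul_eq_mul]
  -- e = 0: reindex to Knopp's sum `∑_{m<ℓ} s(d + mK, ℓK)`, `K = ℓ²K₂`
  set K : ℕ := ℓ ^ 2 * K₂ with hK
  have hKpos : 0 < K := by positivity
  set r : ℕ → ℕ := fun j => Int.toNat ((ρ j * t₀) % ℓ) with hr
  have hℓz : (ℓ : ℤ) ≠ 0 := by exact_mod_cast hℓ.ne_zero
  have hr_nonneg : ∀ j, 0 ≤ (ρ j * t₀) % (ℓ : ℤ) := fun j => Int.emod_nonneg _ hℓz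
  have hr_cast : ∀ j, ((r j : ℕ) : ℤ) = (ρ j * t₀) % ℓ := fun j => Int.toNat_of_nonneg (hr_nonneg j)
  have hr_lt : ∀ j ∈ range ℓ, r j ∈ range ℓ := by
    intro j _
    rw [mem_range]
    have h1 : (ρ j * t₀) % (ℓ : ℤ) < ℓ := Int.emod_lt_of_pos _ (by exact_mod_cast hℓpos)
    have := hr_cast j
    omega
  have hr_inj : Set.InjOn r (range ℓ : Set ℕ) := by
    intro j hj j' hj' e
    have e' : (ρ j * t₀) % (ℓ : ℤ) = (ρ j' * t₀) % ℓ := by rw [← hr_cast, ← hr_cast]; exact_mod_cast e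
    have hdvd : (ℓ : ℤ) ∣ (ρ j - ρ j') * t₀ := by
      rw [sub_mul]; exact Int.ModEq.dvd e'.symm
    have hℓprime : Prime (ℓ : ℤ) := Nat.prime_iff_prime_int.mp hℓ
    rcases hℓprime.dvd_or_dvd hdvd with h | h
    · exact hinj j (mem_coe.mp hj) j' (mem_coe.mp hj') h
    · exact absurd (Int.natCast_dvd_natCast.mp h) hℓt₀
  have he0 : ∑ j ∈ range ℓ, dedekindSum (d + ρ j * C) (ℓ * K) =
      ∑ m ∈ range ℓ, dedekindSum (d + m * K) (ℓ * K) := by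
    have step : ∀ j ∈ range ℓ, dedekindSum (d + ρ j * C) (ℓ * K) =
        (fun m : ℕ => dedekindSum (d + m * K) (ℓ * K)) (r j) := by
      intro j _
      simp only
      -- `ρ_j C = (ρ_j t₀) K = (ℓ q + r_j) K`
      have hdecomp : ρ j * t₀ = (ℓ : ℤ) * (ρ j * t₀ / ℓ) + (r j : ℕ) := by
        rw [hr_cast, Int.emod_def]; ring
      have : d + ρ j * C = (d + (r j : ℕ) * K) + (ρ j * t₀ / ℓ) * ((ℓ * K : ℕ) : ℤ) := by
        rw [hC', hK]
        push_cast
        linear_combination ((ℓ : ℤ) ^ 2 * K₂) * hdecomp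
      rw [this, dedekindSum_add_mul]
    rw [sum_congr rfl step]
    exact sum_range_reindex r hr_lt hr_inj (fun m : ℕ => dedekindSum (d + m * K) (ℓ * K))
  have hknopp := sum_dedekindSum_add_mul_eq hℓ d hKpos
  -- `s(ℓd, ℓ·(ℓK₂)) = s(d, ℓK₂)`
  have hscale : dedekindSum ((ℓ : ℤ) * d) K = dedekindSum d (ℓ * K₂) := by
    rw [hK, show ℓ ^ 2 * K₂ = ℓ * (ℓ * K₂) by ring]
    exact dedekindSum_mul_left_mul_right hℓpos d (ℓ * K₂)
  -- assemble the three terms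
  rw [show (2 + 1 : ℕ) = 3 from rfl]
  simp only [sum_range_succ, sum_range_zero, zero_add, hcoef, hlam0, hlam1, hlam2, hm0, hm1, hm2]
  rw [he0, he1, he2]
  have hℓq : (ℓ : ℚ) ≠ 0 := by exact_mod_cast hℓ.ne_zero
  have eK : ∑ m ∈ range ℓ, dedekindSum (d + m * K) (ℓ * K) =
      ((ℓ : ℚ) + 1) * dedekindSum d K - dedekindSum d (ℓ * K₂) := by
    rw [← hscale]; linear_combination hknopp
  rw [eK]
  field_simp
  ring

/-! ### §3 The `U_ℓ`-transfer sum of `φ_β` vanishes at `ℓ² ∥ N` -/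

/-- The transfer permutation is injective: if `ℓ ∣ b + jd − σ_j(a + jc)` for `j < ℓ` (`ad − bc = 1`, `ℓ ∣ c`), then
`σ_j ≡ σ_{j'} (mod ℓ)` forces `j = j'` (`σ_j ≡ a⁻¹(b + jd)`, `d` invertible mod `ℓ`). [cite: Stevens1982, §2.4–2.5] -/
theorem transfer_index_injective {ℓ : ℕ} (hℓ : ℓ.Prime) {a b c d : ℤ} (hdet : a * d - b * c = 1) (hℓc : (ℓ : ℤ) ∣ c)
    (σ : ℕ → ℤ) (hσ : ∀ j < ℓ, (ℓ : ℤ) ∣ b + j * d - σ j * (a + j * c))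
    {j j' : ℕ} (hj : j < ℓ) (hj' : j' < ℓ) (h : (ℓ : ℤ) ∣ σ j - σ j') : j = j' := by
  have hℓprime : Prime (ℓ : ℤ) := Nat.prime_iff_prime_int.mp hℓ
  have h1 := hσ j hj
  have h2 := hσ j' hj'
  -- `ℓ ∣ (j - j') d`
  have hjd : (ℓ : ℤ) ∣ ((j : ℤ) - j') * d := by
    have e : ((j : ℤ) - j') * d =
        (b + j * d - σ j * (a + j * c)) - (b + j' * d - σ j' * (a + j' * c))
          + (σ j - σ j') * a + c * (σ j * j - σ j' * j') := by ring
    rw [e]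
    exact ((h1.sub h2).add (h.mul_right a)).add (hℓc.mul_right _)
  have hℓd : ¬ (ℓ : ℤ) ∣ d := by
    intro hd
    have : (ℓ : ℤ) ∣ 1 := by
      rw [← hdet]; exact (hd.mul_left a).sub (hℓc.mul_left b)
    exact hℓprime.not_dvd_one this
  rcases hℓprime.dvd_or_dvd hjd with hjj | hd
  · have habs : |(j : ℤ) - j'| < ℓ := by
      rw [abs_lt]; constructor <;> omega
    have := Int.eq_zero_of_abs_lt_dvd hjj habs
    omega
  · exact absurd hd hℓd

/-- **(U2) The `U_ℓ`-transfer of the stabilised Eisenstein period vanishes at a fully depleted prime.**  Let `ℓ` be a prime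
with `ℓ² ∥ N` (`N.factorization ℓ = 2`), `β` admissible stabilisation data, `γ = (a b; c d)` with `ad − bc = 1` and `N ∣ c`
(`γ ∈ Γ₀(N)`), and `σ : ℕ → ℤ` any choice with `ℓ ∣ b + jd − σ_j(a + jc)` for `j < ℓ`.  Then for the transfer matrices
`γ_j = α_j γ α_{σ_j}^{-1} = (a + jc, (b + jd − σ_j(a + jc))/ℓ; ℓc, d − σ_j c)` (`α_j = (1 j; 0 ℓ)`):
`∑_{j<ℓ} φ_β(γ_j) = 0`, `φ_β = stabEisensteinPeriod N β` — the period-function form of `U_ℓ E_β = 0` for the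
`ℓ`-depleted Eisenstein series. [cite: Stevens1982, §2.4–2.5] [cite: Knopp1980, Theorem (n prime)] -/
theorem stabEisensteinPeriod_heckeU_sum_eq_zero {N ℓ : ℕ} (hℓ : ℓ.Prime) (hℓN : N.factorization ℓ = 2)
    {β : ℕ → ℕ} (hadm : IsAdmissibleStabData N β) {a b c d : ℤ} (hdet : a * d - b * c = 1)
    (hc : (N : ℤ) ∣ c) (σ : ℕ → ℤ) (hσ : ∀ j < ℓ, (ℓ : ℤ) ∣ b + j * d - σ j * (a + j * c)) :
    ∑ j ∈ range ℓ, stabEisensteinPeriod N β (a + j * c) ((b + j * d - σ j * (a + j * c)) / ℓ)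
      (ℓ * c) (d - σ j * c) = 0 := by
  have hN0 : N ≠ 0 := by rintro rfl; simp at hℓN
  have hℓN' : ℓ ∣ N := Nat.dvd_of_factorization_pos (by rw [hℓN]; norm_num)
  have hℓc : (ℓ : ℤ) ∣ c := (Int.natCast_dvd_natCast.mpr hℓN').trans hc
  have hℓq : (ℓ : ℚ) ≠ 0 := by exact_mod_cast hℓ.ne_zero
  have hsumt : ∑ t ∈ N.divisors, stabCoeff N β t * t = 0 := sum_divisors_stabCoeff_mul_self_eq_zero hN0 hadm
  simp only [stabEisensteinPeriod_eq]
  rw [sum_comm]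
  by_cases hc0 : c = 0
  · -- `γ = ±T^b`: every `γ_j` is upper triangular, `Φ = (entry ratio)`, and `∑_t c_t t = 0`
    subst hc0
    have had : a * d = 1 := by linear_combination hdet
    have hd0 : (d : ℚ) ≠ 0 := by
      have : d ≠ 0 := by rintro rfl; simp at had
      exact_mod_cast this
    have e : ∀ t ∈ N.divisors, ∑ j ∈ range ℓ, stabCoeff N β t *
        rademacherPhi (a + j * 0) (t * ((b + j * d - σ j * (a + j * 0)) / ℓ)) ((ℓ : ℤ) * 0 / t) (d - σ j * 0) =
        stabCoeff N β t * t * ∑ j ∈ range ℓ, (((b + j * d - σ j * (a + j * 0)) / ℓ : ℤ) : ℚ) / d := by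
      intro t _
      rw [mul_sum]
      refine sum_congr rfl fun j _ => ?_
      simp only [mul_zero, Int.zero_ediv, rademacherPhi_of_c_eq_zero, sub_zero]
      push_cast
      ring
    rw [sum_congr rfl e, ← sum_mul, hsumt, zero_mul]
  · -- `c ≠ 0`
    set C : ℕ := c.natAbs with hC
    have hcC : c = Int.sign c * C := (Int.sign_mul_natAbs c).symm
    have hC0 : C ≠ 0 := Int.natAbs_ne_zero.mpr hc0
    have hCpos : 0 < C := Nat.pos_of_ne_zero hC0
    have hNC : N ∣ C := Int.natCast_dvd.mp hc
    have hsgn : Int.sign c = 1 ∨ Int.sign c = -1 := by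
      rcases lt_or_gt_of_ne hc0 with h | h
      · exact Or.inr (Int.sign_eq_neg_one_of_neg h)
      · exact Or.inl (Int.sign_eq_one_of_pos h)
    have hcq : (c : ℚ) ≠ 0 := by exact_mod_cast hc0
    -- per-divisor facts: `(ℓc)/t = sign(c)·(ℓC/t)`, a nonzero integer of sign `sign c` and modulus `ℓC/t`
    have htC : ∀ t ∈ N.divisors, t ∣ ℓ * C := fun t ht =>
      ((Nat.dvd_of_mem_divisors ht).trans hNC).mul_left ℓ
    have hmod_pos : ∀ t ∈ N.divisors, 0 < ℓ * C / t := fun t ht =>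
      Nat.div_pos (Nat.le_of_dvd (Nat.pos_of_ne_zero (mul_ne_zero hℓ.ne_zero hC0)) (htC t ht))
        (Nat.pos_of_mem_divisors ht)
    have hdivt : ∀ t ∈ N.divisors, ((ℓ : ℤ) * c) / (t : ℤ) = Int.sign c * ((ℓ * C / t : ℕ) : ℤ) := by
      intro t ht
      have ht0 : (t : ℤ) ≠ 0 := by exact_mod_cast (Nat.pos_of_mem_divisors ht).ne'
      obtain ⟨u, hu⟩ := htC t ht
      have hu' : ℓ * C / t = u := by rw [hu, Nat.mul_div_cancel_left _ (Nat.pos_of_mem_divisors ht)]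
      rw [hu']
      have e1 : ((ℓ * C : ℕ) : ℤ) = ((t * u : ℕ) : ℤ) := by rw [hu]
      push_cast at e1
      have e2 : (ℓ : ℤ) * c = (t : ℤ) * (Int.sign c * u) := by
        conv_lhs => rw [hcC]
        linear_combination (Int.sign c) * e1
      rw [e2, Int.mul_ediv_cancel_left _ ht0]
    have hPhi : ∀ t ∈ N.divisors, ∀ j : ℕ,
        rademacherPhi (a + j * c) (t * ((b + j * d - σ j * (a + j * c)) / ℓ)) ((ℓ : ℤ) * c / t) (d - σ j * c) =
        ((a + j * c + (d - σ j * c) : ℤ) : ℚ) * t / ((ℓ : ℚ) * c) -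
          12 * (Int.sign c : ℚ) * dedekindSum (d + (-σ j * Int.sign c) * C) (ℓ * C / t) := by
      intro t ht j
      have htq : (t : ℚ) ≠ 0 := by exact_mod_cast (Nat.pos_of_mem_divisors ht).ne'
      have hupos : (0 : ℤ) < ((ℓ * C / t : ℕ) : ℤ) := by exact_mod_cast hmod_pos t ht
      have hne : ((ℓ : ℤ) * c) / (t : ℤ) ≠ 0 := by
        rw [hdivt t ht]
        exact mul_ne_zero (mt Int.sign_eq_zero_iff_zero.mp hc0) hupos.ne'
      have hs : Int.sign (((ℓ : ℤ) * c) / (t : ℤ)) = Int.sign c := by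
        rw [hdivt t ht, Int.sign_mul, Int.sign_eq_one_of_pos hupos, mul_one]
        rcases hsgn with h | h <;> simp [h]
      have hn : (((ℓ : ℤ) * c) / (t : ℤ)).natAbs = ℓ * C / t := by
        rw [hdivt t ht, Int.natAbs_mul, Int.natAbs_sign_of_ne_zero hc0, one_mul, Int.natAbs_natCast]
      have hdvd : (t : ℤ) ∣ (ℓ : ℤ) * c := by
        have : (t : ℤ) ∣ c := Int.natCast_dvd.mpr ((Nat.dvd_of_mem_divisors ht).trans hNC)
        exact this.mul_left _
      have hqq : ((((ℓ : ℤ) * c) / (t : ℤ) : ℤ) : ℚ) = (ℓ : ℚ) * c / t := by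
        rw [Int.cast_div hdvd (by exact_mod_cast (Nat.pos_of_mem_divisors ht).ne')]
        push_cast; rfl
      have hD : d - σ j * c = d + (-σ j * Int.sign c) * C := by
        conv_lhs => rw [hcC]
        ring
      rw [rademacherPhi_of_c_ne_zero hne, hs, hn, hqq, hD, div_div_eq_mul_div]
    -- the Dedekind-sum block vanishes
    have hinj : ∀ j ∈ range ℓ, ∀ j' ∈ range ℓ, (ℓ : ℤ) ∣ (-σ j * Int.sign c) - (-σ j' * Int.sign c) → j = j' := by
      intro j hj j' hj' h
      have h' : (ℓ : ℤ) ∣ σ j - σ j' := by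
        have e : σ j - σ j' = ((-σ j * Int.sign c) - (-σ j' * Int.sign c)) * (-Int.sign c) := by
          rcases hsgn with hh | hh
          · rw [hh]; ring
          · rw [hh]; ring
        rw [e]; exact h.mul_right _
      exact transfer_index_injective hℓ hdet hℓc σ hσ (mem_range.mp hj) (mem_range.mp hj') h'
    have hG := sum_divisors_stabCoeff_mul_sum_dedekindSum_eq_zero hℓ hℓN β hNC hC0 d
      (fun j => -σ j * Int.sign c) hinj
    -- the rational parts: a multiple of `∑_t c_t t = 0`
    set S : ℚ := ∑ j ∈ range ℓ, ((a + j * c + (d - σ j * c) : ℤ) : ℚ) with hS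
    have per_t : ∀ t ∈ N.divisors,
        ∑ j ∈ range ℓ, stabCoeff N β t *
          rademacherPhi (a + j * c) (t * ((b + j * d - σ j * (a + j * c)) / ℓ)) ((ℓ : ℤ) * c / t) (d - σ j * c) =
        stabCoeff N β t * t * (S / ((ℓ : ℚ) * c)) - 12 * (Int.sign c : ℚ) *
          (stabCoeff N β t * ∑ j ∈ range ℓ, dedekindSum (d + (-σ j * Int.sign c) * C) (ℓ * C / t)) := by
      intro t ht
      rw [sum_congr rfl fun j _ => by rw [hPhi t ht j]]
      rw [sum_congr rfl fun j _ => show stabCoeff N β t *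
          (((a + j * c + (d - σ j * c) : ℤ) : ℚ) * t / ((ℓ : ℚ) * c) -
            12 * (Int.sign c : ℚ) * dedekindSum (d + (-σ j * Int.sign c) * C) (ℓ * C / t)) =
          (stabCoeff N β t * t / ((ℓ : ℚ) * c)) * ((a + j * c + (d - σ j * c) : ℤ) : ℚ) -
            (12 * (Int.sign c : ℚ) * stabCoeff N β t) * dedekindSum (d + (-σ j * Int.sign c) * C) (ℓ * C / t) by
          ring]
      rw [sum_sub_distrib, ← mul_sum, ← mul_sum, hS]
      field_simp
    rw [sum_congr rfl per_t, sum_sub_distrib, ← sum_mul, ← mul_sum, hsumt, hG]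
    ring

end Summit.BirchSwinnertonDyer.BirchSwinnertonDyer.Theorems.DepletionAtTwo

end
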